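import Mathlib.Analysis.SpecialFunctions.Log.Basic
import Mathlib.Analysis.SpecialFunctions.Trigonometric.Series
import Mathlib.NumberTheory.Harmonic.Bounds
import Literature.MathematicalPhysics.QuantumLattice.LatticeTori
import HarnessLib

/-!
# The torus metric: symmetry, triangle inequality, ball counting, McBryan–Spencer test functions

Trunk T-QLATTICE, topic `MathematicalPhysics/QuantumLattice`. Sibling proof file of
`Literature/MathematicalPhysics/QuantumLattice/LatticeTori.lean`: it discharges the two named facts
of that file and proves the elementary lattice geometry consumed by the Koma–Tasaki bounds
(hubbard.S11, `HubbardHubbardModelKomaTasakiProofs.lean`). No statement is introduced or changed.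

Proved here:

* `torusDist_comm_holds`, `torusDist_triangle_holds` — discharges of the named facts
  `torusDist_comm`, `torusDist_triangle` of `LatticeTori` (symmetry and triangle inequality of the
  periodic sup-distance on a rectangular torus `Π i, ZMod (Ls i)`), from the corresponding facts
  `cyclicAbs_neg`, `cyclicAbs_add_le` for the cyclic absolute value `min (z.val, n - z.val)` on
  `ZMod n`; usable forms `torusDist_comm'`, `torusDist_triangle'`.
* Counting on the cubic torus `(ℤ/Lℤ)^d`: level sets of the cyclic absolute value have at most
  `2` points and sublevel sets `{≤ r}` at most `2r + 1` (`card_filter_cyclicAbs_eq_le`,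
  `card_filter_cyclicAbs_le_le`); spheres of the torus metric have at most `d · 2 (2r+1)^{d-1}`
  sites (`card_filter_torusDist_eq_le`); degrees of the torus graph are at most `2d`
  (`card_filter_adj_le`); adjacent sites are at distance `≤ 1` (`torusDist_le_one_of_adj`);
  `torusDist < L` (`torusDist_lt`).
* Two summation lemmas: symmetrisation of a nearest-neighbour double sum against a degree bound
  (`sum_adj_le_of_le_add`) and radial summation against the sphere count (`sum_radial_le`).
* Two real inequalities: `cosh s - 1 ≤ s²` for `|s| ≤ 1` (`cosh_sub_one_le_sq`) and
  `|log (a+1) - log (b+1)| ≤ 1 / (min a b + 1)` for natural numbers `a, b` differing by at most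
  one (`abs_log_succ_sub_log_succ_le`).
* **McBryan–Spencer test functions** with explicit, `L`-uniform constants
  (`exists_testFunction_two`, `exists_testFunction_one`): for sites `x, y` of `(ℤ/Lℤ)²` at torus
  distance `R` and `0 ≤ q ≤ 1` there is `ψ` with `ψ x - ψ y = q log (R + 1)` and
  `Σ_u Σ_v [u ∼ v] (cosh (ψ u - ψ v) - 1) ≤ 64 q² (log (R + 1) + 1)` (ordered nearest-neighbour
  pairs); on the ring `ℤ/Lℤ`, `ψ x - ψ y = q R` with energy `≤ 8 q² R`. These realise the
  properties P1 ("bounded gradient": here `|∇ψ| ≤ q ≤ 1`, so that `cosh - 1 ≤ (∇ψ)²`) and P2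
  (`φ_x - φ_y ≥ q α ln |x - y|` in `d = 2`, `≥ q γ |x - y|` in `d = 1`) of the solution of the
  lattice Poisson equation used by Koma–Tasaki (PRL 68 (1992) 3248, after eq. (11)), by the
  explicit truncated profiles `ψ (u) = q log (min (dist (u, y), R) + 1)` (McBryan–Spencer 1977)
  and `ψ (u) = q min (dist (u, y), R)`, whose Dirichlet energies are bounded by radial summation
  (`Σ_{r < R} (2r + 1) (r + 1)⁻² ≤ 2 · harmonic (R) ≤ 2 (1 + log R)`), uniformly in `L` and with
  no Fourier analysis.

## Sources

O. A. McBryan, T. Spencer, *On the decay of correlations in SO(n)-symmetric ferromagnets*,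
Comm. Math. Phys. **53** (1977) 299–302 (the logarithmic test function); T. Koma, H. Tasaki,
PRL **68** (1992) 3248 = arXiv:cond-mat/9709068, properties P1, P2 after eq. (11);
S. Friedli, Y. Velenik, *Statistical Mechanics of Lattice Systems* (CUP 2017), §3.1 (periodic
boundary conditions, the torus metric).

## Mathlib search

Mathlib supplies `ZMod.val`, `ZMod.neg_val`, `ZMod.val_add_of_lt`, `ZMod.val_add_val_of_le`,
`Finset.sup`, `Fintype.piFinset`/`Fintype.card_piFinset`, `Finset.card_biUnion_le`,
`Finset.sum_fiberwise_of_maps_to`, `harmonic_le_one_add_log`, `Real.cosh_le_exp_half_sq`,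
`Real.add_one_le_exp`, `Real.log_le_sub_one_of_pos`; it has no periodic (torus) metric on
`Fin d → ZMod L` (`rg -i "torus.*dist|ZMod.*metric"` over Mathlib: nothing relevant).

## Design notes

* Symmetry and the triangle inequality are proved in the rectangular generality of `LatticeTori`
  (`RectTorusSite Ls`); the counting lemmas and test functions on cubic tori
  `StatMech.TorusSite d L = RectTorusSite (fun _ => L)` (definitional), with `[NeZero L]`.
* Nearest-neighbour sums are double sums `Σ_u Σ_v [u ∼ v] …` over ordered pairs of
  `StatMech.torusGraph d L` (each edge twice), the format of the Hubbard hopping term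
  `QLattice.hoppingSum`.
-/

open Finset

namespace Literature.MathematicalPhysics.QuantumLattice

open Literature.Probability.LatticeModels

/-! ### The cyclic absolute value on `ZMod n` and the rectangular torus metric -/

section Rect

variable {d : ℕ} {Ls : Fin d → ℕ}

/-- The cyclic absolute value `|z| = min (z.val, n - z.val)` on `ZMod n` is even: `|-z| = |z|`.
(Friedli–Velenik 2017, §3.1.) [folklore] -/
theorem cyclicAbs_neg (n : ℕ) (z : ZMod n) : min (-z).val (n - (-z).val) = min z.val (n - z.val) := by
  rcases n with _ | n
  · simp
  · rcases eq_or_ne z 0 with rfl | hz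
    · simp
    · rw [ZMod.neg_val, if_neg hz]
      have := ZMod.val_lt z
      have h0 : 0 < z.val := Nat.pos_of_ne_zero ((ZMod.val_ne_zero z).mpr hz)
      omega

/-- The cyclic absolute value on `ZMod n` (`n ≠ 0`) is subadditive: `|a + b| ≤ |a| + |b|`.
(Friedli–Velenik 2017, §3.1.) [folklore] -/
theorem cyclicAbs_add_le (n : ℕ) [NeZero n] (a b : ZMod n) :
    min (a + b).val (n - (a + b).val) ≤ min a.val (n - a.val) + min b.val (n - b.val) := by
  have ha := ZMod.val_lt a
  have hb := ZMod.val_lt b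
  rcases lt_or_ge (a.val + b.val) n with h | h
  · rw [ZMod.val_add_of_lt h]
    omega
  · have h2 := ZMod.val_add_val_of_le h
    omega

/-- The periodic sup-norm on a rectangular torus is even: `‖-x‖ = ‖x‖`.
(Friedli–Velenik 2017, §3.1.) [folklore] -/
theorem torusNorm_neg (x : RectTorusSite Ls) : torusNorm (-x) = torusNorm x := by
  simp only [torusNorm, Pi.neg_apply, cyclicAbs_neg]

/-- The periodic sup-norm on a rectangular torus with nonzero sides is subadditive:
`‖x + y‖ ≤ ‖x‖ + ‖y‖`. (Friedli–Velenik 2017, §3.1.) [folklore] -/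
theorem torusNorm_add_le [∀ i, NeZero (Ls i)] (x y : RectTorusSite Ls) :
    torusNorm (x + y) ≤ torusNorm x + torusNorm y := by
  simp only [torusNorm]
  refine Finset.sup_le fun i _ => ?_
  calc _ ≤ _ := cyclicAbs_add_le (Ls i) (x i) (y i)
    _ ≤ _ := add_le_add
        (le_sup (f := fun i => min (x i).val (Ls i - (x i).val)) (mem_univ i))
        (le_sup (f := fun i => min (y i).val (Ls i - (y i).val)) (mem_univ i))

/-- **Discharge of the named fact `torusDist_comm`** (`LatticeTori`): the torus distance
`dist (x, y) = ‖x - y‖` is symmetric, since the periodic sup-norm is even.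
(Friedli–Velenik 2017, §3.1.) [cite: FriedliVelenik2017, §3.1] -/
theorem torusDist_comm_holds : torusDist_comm (Ls := Ls) := by
  intro x y
  unfold torusDist
  rw [← neg_sub, torusNorm_neg]

/-- **Discharge of the named fact `torusDist_triangle`** (`LatticeTori`): the torus distance
satisfies the triangle inequality (nonzero sides), since the periodic sup-norm is subadditive
and `x - z = (x - y) + (y - z)`. (Friedli–Velenik 2017, §3.1.) [cite: FriedliVelenik2017, §3.1] -/
theorem torusDist_triangle_holds : torusDist_triangle (Ls := Ls) := by
  intro _ x y z
  unfold torusDist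
  have : x - z = (x - y) + (y - z) := by abel
  rw [this]
  exact torusNorm_add_le _ _

/-- Symmetry of the torus distance (usable form of `torusDist_comm_holds`).
(Friedli–Velenik 2017, §3.1.) [folklore] -/
theorem torusDist_comm' (x y : RectTorusSite Ls) : torusDist x y = torusDist y x :=
  torusDist_comm_holds x y

/-- Triangle inequality for the torus distance (usable form of `torusDist_triangle_holds`).
(Friedli–Velenik 2017, §3.1.) [folklore] -/
theorem torusDist_triangle' [∀ i, NeZero (Ls i)] (x y z : RectTorusSite Ls) :
    torusDist x z ≤ torusDist x y + torusDist y z :=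
  torusDist_triangle_holds x y z

end Rect

/-! ### Counting on one coordinate: level and sublevel sets of the cyclic absolute value -/

section Cyclic

variable {L : ℕ} [NeZero L]

/-- `|1| ≤ 1` for the cyclic absolute value on `ZMod L` (it is `0` when `L = 1`). [folklore] -/
theorem cyclicAbs_one_le : min (1 : ZMod L).val (L - (1 : ZMod L).val) ≤ 1 := by
  rw [ZMod.val_one_eq_one_mod]
  rcases Nat.lt_or_ge 1 L with h | h
  · rw [Nat.mod_eq_of_lt h]; exact min_le_left _ _
  · have : L = 1 := le_antisymm h (Nat.pos_of_ne_zero (NeZero.ne L))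
    subst this
    simp

/-- The cyclic absolute value on `ZMod L` is `< L`. [folklore] -/
theorem cyclicAbs_lt (z : ZMod L) : min z.val (L - z.val) < L :=
  (min_le_left _ _).trans_lt (ZMod.val_lt z)

/-- Level sets of the cyclic absolute value have at most two points: `{z | |z| = r} ⊆ {r, L - r}`.
[folklore] -/
theorem card_filter_cyclicAbs_eq_le (r : ℕ) :
    (univ.filter fun z : ZMod L => min z.val (L - z.val) = r).card ≤ 2 := by
  have hsub : (univ.filter fun z : ZMod L => min z.val (L - z.val) = r) ⊆
      {(r : ZMod L), ((L - r : ℕ) : ZMod L)} := by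
    intro z hz
    simp only [mem_filter, mem_univ, true_and] at hz
    simp only [mem_insert, mem_singleton]
    have hzL := ZMod.val_lt z
    rcases min_choice z.val (L - z.val) with h | h
    · left
      have : z.val = r := by omega
      rw [← this, ZMod.natCast_zmod_val]
    · right
      have : z.val = L - r := by omega
      rw [← this, ZMod.natCast_zmod_val]
  exact (card_le_card hsub).trans (card_insert_le _ _ |>.trans (by simp))

/-- Sublevel sets of the cyclic absolute value have at most `2r + 1` points:
`{z | |z| ≤ r} ⊆ {0, …, r} ∪ {L - 1, …, L - r}`. [folklore] -/
theorem card_filter_cyclicAbs_le_le (r : ℕ) :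
    (univ.filter fun z : ZMod L => min z.val (L - z.val) ≤ r).card ≤ 2 * r + 1 := by
  have hsub : (univ.filter fun z : ZMod L => min z.val (L - z.val) ≤ r) ⊆
      (range (r + 1)).image (fun k : ℕ => (k : ZMod L)) ∪
        (range r).image (fun k : ℕ => ((L - 1 - k : ℕ) : ZMod L)) := by
    intro z hz
    simp only [mem_filter, mem_univ, true_and] at hz
    simp only [mem_union, mem_image, mem_range]
    have hzL := ZMod.val_lt z
    rcases le_or_gt z.val r with h | h
    · left; exact ⟨z.val, by omega, ZMod.natCast_zmod_val z⟩
    · right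
      refine ⟨L - 1 - z.val, by omega, ?_⟩
      have : L - 1 - (L - 1 - z.val) = z.val := by omega
      rw [this, ZMod.natCast_zmod_val]
  calc _ ≤ _ := card_le_card hsub
    _ ≤ ((range (r + 1)).image (fun k : ℕ => (k : ZMod L))).card +
          ((range r).image (fun k : ℕ => ((L - 1 - k : ℕ) : ZMod L))).card := card_union_le _ _
    _ ≤ (r + 1) + r := by
        gcongr
        · exact card_image_le.trans (card_range _).le
        · exact card_image_le.trans (card_range _).le
    _ = 2 * r + 1 := by ring

end Cyclic

/-! ### The metric of the cubic torus `(ℤ/Lℤ)^d` -/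

section TorusMetric

variable {d L : ℕ} [NeZero L]

/-- The torus distance on `(ℤ/Lℤ)^d` is `< L` (every coordinate representative is `< L`).
[folklore] -/
theorem torusDist_lt (x y : TorusSite d L) : torusDist x y < L := by
  unfold torusDist
  simp only [torusNorm]
  refine (Finset.sup_lt_iff (Nat.pos_of_ne_zero (NeZero.ne L))).mpr fun i _ => ?_
  exact cyclicAbs_lt _

/-- Adjacent sites of the torus graph `StatMech.torusGraph d L` (`y = x ± e_i`) are at torus
distance at most `1` (distance `0` occurs only for `L = 1`). (Friedli–Velenik 2017, §3.1.)
[folklore] -/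
theorem torusDist_le_one_of_adj {x y : TorusSite d L} (h : (torusGraph d L).Adj x y) :
    torusDist x y ≤ 1 := by
  have key : ∀ i : Fin d, torusNorm (Ls := fun _ => L) (Pi.single i (1 : ZMod L) : TorusSite d L) ≤ 1 := by
    intro i
    simp only [torusNorm]
    refine Finset.sup_le fun j _ => ?_
    rcases eq_or_ne j i with rfl | hj
    · rw [Pi.single_eq_same]; exact cyclicAbs_one_le
    · rw [Pi.single_eq_of_ne hj]; simp
  rw [torusGraph_adj_iff] at h
  obtain ⟨-, ⟨i, hi⟩ | ⟨i, hi⟩⟩ := h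
  · rw [torusDist_comm']
    unfold torusDist
    rw [hi, add_sub_cancel_left]
    exact key i
  · unfold torusDist
    rw [hi, add_sub_cancel_left]
    exact key i

end TorusMetric

/-! ### Spheres and degrees -/

section Counting

variable {d L : ℕ} [NeZero L]

/-- **Sphere counting** on the cubic torus `(ℤ/Lℤ)^d`, `d ≥ 1`: the sphere
`{u | dist (u, y) = r}` has at most `d · 2 (2r + 1)^{d-1}` sites (some coordinate of `u - y` has
cyclic absolute value exactly `r` — at most `2` choices — and the other `d - 1` coordinates have
cyclic absolute value `≤ r` — at most `2r + 1` choices each). [folklore] -/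
theorem card_filter_torusDist_eq_le (hd : 0 < d) (y : TorusSite d L) (r : ℕ) :
    (univ.filter fun u : TorusSite d L => torusDist u y = r).card ≤
      d * (2 * (2 * r + 1) ^ (d - 1)) := by
  classical
  set A : Finset (ZMod L) := univ.filter fun z : ZMod L => min z.val (L - z.val) = r with hA
  set B : Finset (ZMod L) := univ.filter fun z : ZMod L => min z.val (L - z.val) ≤ r with hB
  have hAc : A.card ≤ 2 := card_filter_cyclicAbs_eq_le r
  have hBc : B.card ≤ 2 * r + 1 := card_filter_cyclicAbs_le_le r
  let C : Fin d → Fin d → Finset (ZMod L) := fun i j => if j = i then A else B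
  let T : Fin d → Finset (TorusSite d L) := fun i =>
    univ.filter fun u : TorusSite d L => (u - y) ∈ Fintype.piFinset (C i)
  have hne : (univ : Finset (Fin d)).Nonempty := ⟨⟨0, hd⟩, mem_univ _⟩
  have hsub : (univ.filter fun u : TorusSite d L => torusDist u y = r) ⊆ univ.biUnion T := by
    intro u hu
    simp only [mem_filter, mem_univ, true_and] at hu
    unfold torusDist at hu
    simp only [torusNorm] at hu
    obtain ⟨i, -, hi⟩ := Finset.exists_mem_eq_sup univ hne
      (fun i => min ((u - y) i).val (L - ((u - y) i).val))
    simp only [mem_biUnion, mem_univ, true_and, T, mem_filter, Fintype.mem_piFinset, C]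
    refine ⟨i, fun j => ?_⟩
    split_ifs with hj
    · simp only [hA, mem_filter, mem_univ, true_and]
      rw [hj, ← hi, hu]
    · simp only [hB, mem_filter, mem_univ, true_and]
      rw [← hu]
      exact Finset.le_sup (f := fun i => min ((u - y) i).val (L - ((u - y) i).val)) (mem_univ j)
  have hT : ∀ i, (T i).card ≤ 2 * (2 * r + 1) ^ (d - 1) := by
    intro i
    calc (T i).card ≤ (Fintype.piFinset (C i)).card := by
          refine Finset.card_le_card_of_injOn (fun u => u - y) ?_ ?_
          · intro u hu
            simp only [T, coe_filter, mem_univ, true_and, Set.mem_setOf_eq] at hu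
            exact hu
          · intro u _ v _ h
            simpa using h
      _ = ∏ j, (C i j).card := Fintype.card_piFinset _
      _ ≤ ∏ j : Fin d, (if j = i then 2 else 2 * r + 1) := by
          refine Finset.prod_le_prod' fun j _ => ?_
          simp only [C]
          split_ifs
          · exact hAc
          · exact hBc
      _ = 2 * (2 * r + 1) ^ (d - 1) := by
          rw [← Finset.mul_prod_erase univ _ (mem_univ i), if_pos rfl]
          congr 1
          rw [Finset.prod_congr rfl (fun j hj => if_neg (ne_of_mem_erase hj)), prod_const,
            card_erase_of_mem (mem_univ i), card_univ, Fintype.card_fin]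
  calc _ ≤ (univ.biUnion T).card := card_le_card hsub
    _ ≤ ∑ i, (T i).card := card_biUnion_le
    _ ≤ ∑ _i : Fin d, 2 * (2 * r + 1) ^ (d - 1) := sum_le_sum fun i _ => hT i
    _ = d * (2 * (2 * r + 1) ^ (d - 1)) := by simp

/-- **Degree bound**: every site of the torus graph `StatMech.torusGraph d L` has at most `2d`
neighbours (`u ± e_i`, `i < d`). (Friedli–Velenik 2017, §3.1.) [folklore] -/
theorem card_filter_adj_le (u : TorusSite d L) :
    (univ.filter fun v : TorusSite d L => (torusGraph d L).Adj u v).card ≤ 2 * d := by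
  classical
  have hsub : (univ.filter fun v : TorusSite d L => (torusGraph d L).Adj u v) ⊆
      (univ : Finset (Fin d × Bool)).image
        fun p => if p.2 then u + Pi.single p.1 1 else u - Pi.single p.1 1 := by
    intro v hv
    simp only [mem_filter, mem_univ, true_and, torusGraph_adj_iff] at hv
    obtain ⟨-, ⟨i, hi⟩ | ⟨i, hi⟩⟩ := hv
    · exact mem_image.mpr ⟨(i, true), mem_univ _, by simp [hi]⟩
    · exact mem_image.mpr ⟨(i, false), mem_univ _, by simp [hi]⟩
  calc _ ≤ _ := card_le_card hsub
    _ ≤ (univ : Finset (Fin d × Bool)).card := card_image_le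
    _ = 2 * d := by simp [mul_comm]

end Counting

/-! ### Two summation lemmas -/

section Sums

variable {d L : ℕ} [NeZero L]

/-- **Symmetrisation of a nearest-neighbour double sum.** If `T u v ≤ G u + G v` on edges,
`G ≥ 0`, and every degree is at most `2d`, then `Σ_u Σ_v [u ∼ v] T u v ≤ 2 (2d) Σ_u G u`.
[folklore] -/
theorem sum_adj_le_of_le_add (T : TorusSite d L → TorusSite d L → ℝ) (G : TorusSite d L → ℝ)
    (hG : ∀ u, 0 ≤ G u) (hT : ∀ u v, (torusGraph d L).Adj u v → T u v ≤ G u + G v)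
    (hdeg : ∀ u : TorusSite d L,
      (univ.filter fun v : TorusSite d L => (torusGraph d L).Adj u v).card ≤ 2 * d) :
    ∑ u, ∑ v, (if (torusGraph d L).Adj u v then T u v else 0) ≤ 2 * (2 * d) * ∑ u, G u := by
  have h1 : ∀ u, ∑ v, (if (torusGraph d L).Adj u v then T u v else 0) ≤
      ∑ v, (if (torusGraph d L).Adj u v then G u else 0) +
        ∑ v, (if (torusGraph d L).Adj u v then G v else 0) := by
    intro u
    rw [← sum_add_distrib]
    refine sum_le_sum fun v _ => ?_
    split_ifs with h
    · exact hT u v h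
    · simp
  have hdegsum : ∀ (u : TorusSite d L) (c : ℝ), 0 ≤ c →
      ∑ v, (if (torusGraph d L).Adj u v then c else 0) ≤ 2 * d * c := by
    intro u c hc
    rw [sum_ite, sum_const_zero, add_zero, sum_const, nsmul_eq_mul]
    have := hdeg u
    calc _ ≤ ((2 * d : ℕ) : ℝ) * c := mul_le_mul_of_nonneg_right (by exact_mod_cast this) hc
      _ = _ := by push_cast; ring
  have hdegsum' : ∀ (v : TorusSite d L) (c : ℝ), 0 ≤ c →
      ∑ u, (if (torusGraph d L).Adj u v then c else 0) ≤ 2 * d * c := by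
    intro v c hc
    have := hdegsum v c hc
    simpa only [(torusGraph d L).adj_comm] using this
  calc _ ≤ ∑ u, (∑ v, (if (torusGraph d L).Adj u v then G u else 0) +
        ∑ v, (if (torusGraph d L).Adj u v then G v else 0)) := sum_le_sum fun u _ => h1 u
    _ = ∑ u, ∑ v, (if (torusGraph d L).Adj u v then G u else 0) +
        ∑ v, ∑ u, (if (torusGraph d L).Adj u v then G v else 0) := by
        rw [sum_add_distrib, sum_comm (f := fun u v => if (torusGraph d L).Adj u v then G v else 0)]
    _ ≤ ∑ u, 2 * d * G u + ∑ v, 2 * d * G v :=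
        add_le_add (sum_le_sum fun u _ => hdegsum u _ (hG u)) (sum_le_sum fun v _ => hdegsum' v _ (hG v))
    _ = 2 * (2 * d) * ∑ u, G u := by rw [← mul_sum]; ring

/-- **Radial summation.** For `F ≥ 0`, `Σ_u F (dist (u, y)) ≤ Σ_{r < L} #sphere(r) · F r`, with the
sphere count bounded by `d · 2 (2r + 1)^{d-1}` (`card_filter_torusDist_eq_le`). [folklore] -/
theorem sum_radial_le (F : ℕ → ℝ) (hF : ∀ r, 0 ≤ F r) (y : TorusSite d L)
    (hsphere : ∀ r, (univ.filter fun u : TorusSite d L => torusDist u y = r).card ≤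
      d * (2 * (2 * r + 1) ^ (d - 1)))
    (hlt : ∀ u : TorusSite d L, torusDist u y < L) :
    ∑ u : TorusSite d L, F (torusDist u y) ≤
      ∑ r ∈ range L, (d * (2 * (2 * r + 1) ^ (d - 1)) : ℕ) * F r := by
  rw [← sum_fiberwise_of_maps_to (s := univ) (t := range L) (g := fun u => torusDist u y)
    (fun u _ => mem_range.mpr (hlt u))]
  refine sum_le_sum fun r _ => ?_
  rw [sum_congr rfl (fun u hu => by rw [(mem_filter.mp hu).2]), sum_const, nsmul_eq_mul]
  exact mul_le_mul_of_nonneg_right (by exact_mod_cast hsphere r) (hF r)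

end Sums

/-! ### Two real inequalities -/

/-- `cosh s - 1 ≤ s²` for `|s| ≤ 1` (from `cosh s ≤ e^{s²/2}` and `e^x ≤ 1/(1 - x) ≤ 1 + 2x` on
`[0, 1/2]`); this is the inequality `cosh (φ_u - φ_v) - 1 ≤ g(q) (φ_u - φ_v)²` of Koma–Tasaki
under their bounded-gradient property P1. Koma–Tasaki, PRL 68 (1992) 3248, sentence after
eq. (11). [folklore] -/
theorem cosh_sub_one_le_sq {s : ℝ} (hs : |s| ≤ 1) : Real.cosh s - 1 ≤ s ^ 2 := by
  have h1 : Real.cosh s ≤ Real.exp (s ^ 2 / 2) := Real.cosh_le_exp_half_sq s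
  have hs2 : s ^ 2 ≤ 1 := by
    have := abs_le.mp hs
    nlinarith
  have h2 : Real.exp (s ^ 2 / 2) ≤ 1 + s ^ 2 := by
    have hx : s ^ 2 / 2 ≤ 1 / 2 := by linarith
    have h0 : 0 ≤ s ^ 2 / 2 := by positivity
    -- exp x ≤ 1 + 2x for 0 ≤ x ≤ 1/2 : from exp x ≤ 1/(1-x)
    have h3 : Real.exp (s ^ 2 / 2) ≤ 1 / (1 - s ^ 2 / 2) := by
      have := Real.add_one_le_exp (-(s ^ 2 / 2))
      rw [Real.exp_neg] at this
      rw [le_div_iff₀ (by linarith)]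
      have hpos := Real.exp_pos (s ^ 2 / 2)
      have h4 := mul_le_mul_of_nonneg_left this hpos.le
      rw [mul_inv_cancel₀ hpos.ne'] at h4
      linarith
    calc _ ≤ _ := h3
      _ ≤ 1 + s ^ 2 := by
          rw [div_le_iff₀ (by linarith)]
          nlinarith
  linarith

/-- For natural numbers `a, b` with `|a - b| ≤ 1`, `|log (a + 1) - log (b + 1)| ≤ 1 / (min a b + 1)`
(`log t ≤ t - 1`): the bounded, `1/r`-decaying gradient of the logarithmic McBryan–Spencer
profile. McBryan–Spencer, Comm. Math. Phys. 53 (1977) 299. [folklore] -/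
theorem abs_log_succ_sub_log_succ_le (a b : ℕ) (hab : a ≤ b + 1) (hba : b ≤ a + 1) :
    |Real.log (a + 1) - Real.log (b + 1)| ≤ 1 / (min a b + 1) := by
  wlog h : a ≤ b generalizing a b
  · rw [abs_sub_comm, min_comm]
    exact this b a hba hab (le_of_not_ge h)
  rw [min_eq_left h]
  have ha : (0 : ℝ) < a + 1 := by positivity
  have hb : (0 : ℝ) < b + 1 := by positivity
  rw [abs_sub_comm, abs_of_nonneg (by rw [sub_nonneg]; exact Real.log_le_log ha (by exact_mod_cast Nat.succ_le_succ h)),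
    ← Real.log_div hb.ne' ha.ne']
  calc _ ≤ (b + 1 : ℝ) / (a + 1) - 1 := Real.log_le_sub_one_of_pos (by positivity)
    _ ≤ 1 / (a + 1) := by
        rw [div_sub_one ha.ne', div_le_div_iff_of_pos_right ha]
        have : (b : ℝ) ≤ a + 1 := by exact_mod_cast hba
        linarith

/-! ### McBryan–Spencer test functions on the torus -/

section TestFunctions

variable {L : ℕ} [NeZero L]

/-- The truncated distance `u ↦ min (dist (u, y), R)` is `1`-Lipschitz along the edges of the
torus graph. [folklore] -/
theorem min_torusDist_lipschitz {d : ℕ} (y : TorusSite d L) (R : ℕ) {u v : TorusSite d L}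
    (h : (torusGraph d L).Adj u v) :
    min (torusDist u y) R ≤ min (torusDist v y) R + 1 ∧
      min (torusDist v y) R ≤ min (torusDist u y) R + 1 := by
  have h1 : torusDist u y ≤ 1 + torusDist v y :=
    (torusDist_triangle' u v y).trans (by have := torusDist_le_one_of_adj h; omega)
  have h2 : torusDist v y ≤ 1 + torusDist u y :=
    (torusDist_triangle' v u y).trans (by
      have := torusDist_le_one_of_adj ((torusGraph d L).adj_symm h); omega)
  constructor <;> omega

/-- **McBryan–Spencer test function on the two-dimensional torus** (uniform in `L`). For
`x, y ∈ (ℤ/Lℤ)²` at torus distance `R` and `0 ≤ q ≤ 1`, the profile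
`ψ (u) = q log (min (dist (u, y), R) + 1)` satisfies `ψ x - ψ y = q log (R + 1)` and
`Σ_u Σ_v [u ∼ v] (cosh (ψ u - ψ v) - 1) ≤ 64 q² (log (R + 1) + 1)`: along an edge
`|ψ u - ψ v| ≤ q / (min + 1) ≤ 1`, so `cosh - 1 ≤ (ψ u - ψ v)² ≤ q² (dist + 1)⁻²` at the endpoint
closer to `y` (and `0` outside the ball of radius `R`); symmetrise with degree `≤ 4`, and sum
radially with `#sphere(r) ≤ 4 (2r + 1)`: `Σ_{r < R} 4 (2r+1) (r+1)⁻² ≤ 8 Σ_{r < R} (r+1)⁻¹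
≤ 8 (log (R + 1) + 1)`. This realises Koma–Tasaki's properties P1 (bounded gradient) and P2
(`φ_x - φ_y ≥ q α ln |x - y|`, here `α = 1` and `+1` inside the logarithm) with an explicit
energy bound. McBryan–Spencer, Comm. Math. Phys. 53 (1977) 299; Koma–Tasaki, PRL 68 (1992)
3248, P1, P2 after eq. (11). [cite: KomaTasakiPRL1992, properties P1 and P2 after eq. (11)] -/
theorem exists_testFunction_two (x y : TorusSite 2 L) {q : ℝ} (hq0 : 0 ≤ q) (hq1 : q ≤ 1) :
    ∃ ψ : TorusSite 2 L → ℝ,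
      ψ x - ψ y = q * Real.log (torusDist x y + 1) ∧
      ∑ u, ∑ v, (if (torusGraph 2 L).Adj u v then Real.cosh (ψ u - ψ v) - 1 else 0) ≤
        64 * q ^ 2 * (Real.log (torusDist x y + 1) + 1) := by
  set R : ℕ := torusDist x y with hR
  set m : TorusSite 2 L → ℕ := fun u => min (torusDist u y) R with hm
  refine ⟨fun u => q * Real.log (m u + 1), ?_, ?_⟩
  · have hx : m x = R := by simp [hm, hR]
    have hy : m y = 0 := by simp [hm]
    show q * Real.log (m x + 1) - q * Real.log (m y + 1) = _
    rw [hx, hy]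
    simp
  · -- the comparison function
    set g : TorusSite 2 L → ℝ := fun u =>
      if torusDist u y < R then 1 / ((torusDist u y : ℝ) + 1) ^ 2 else 0 with hg
    have hg0 : ∀ u, 0 ≤ g u := fun u => by
      simp only [hg]; split_ifs <;> positivity
    have hkey : ∀ u v, (torusGraph 2 L).Adj u v →
        Real.cosh (q * Real.log (m u + 1) - q * Real.log (m v + 1)) - 1 ≤
          q ^ 2 * g u + q ^ 2 * g v := by
      intro u v huv
      obtain ⟨h1, h2⟩ := min_torusDist_lipschitz y R huv
      rcases eq_or_ne (m u) (m v) with heq | hne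
      · rw [heq, sub_self, Real.cosh_zero, sub_self]
        have := hg0 u; have := hg0 v; positivity
      · have hdiff : |q * Real.log (m u + 1) - q * Real.log (m v + 1)| ≤
            q / (min (m u) (m v) + 1) := by
          rw [← mul_sub, abs_mul, abs_of_nonneg hq0, div_eq_mul_one_div]
          exact mul_le_mul_of_nonneg_left (abs_log_succ_sub_log_succ_le _ _ h1 h2) hq0
        have hle1 : |q * Real.log (m u + 1) - q * Real.log (m v + 1)| ≤ 1 := by
          refine hdiff.trans ((div_le_self hq0 ?_).trans hq1)
          have : (0 : ℝ) ≤ min (m u) (m v) := by positivity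
          linarith
        have h := sq_le_sq' (abs_le.mp hdiff).1 (abs_le.mp hdiff).2
        refine (cosh_sub_one_le_sq hle1).trans (h.trans ?_)
        -- identify the smaller of `m u`, `m v` with a true distance `< R`
        rcases Nat.lt_or_gt_of_ne hne with hlt | hlt
        · have hmu : m u < R := lt_of_lt_of_le hlt (min_le_right _ _)
          have hdu : torusDist u y < R := by
            by_contra hc
            have : m u = R := by simp only [hm]; exact min_eq_right (not_lt.mp hc)
            omega
          have hmu' : m u = torusDist u y := by simp only [hm]; exact min_eq_left hdu.le
          have hgu : g u = 1 / ((torusDist u y : ℝ) + 1) ^ 2 := by simp only [hg, if_pos hdu]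
          rw [min_eq_left hlt.le, hmu']
          calc (q / ((torusDist u y : ℕ) + 1 : ℝ)) ^ 2 = q ^ 2 * g u := by
                rw [hgu, div_pow, one_div, div_eq_mul_inv]
            _ ≤ q ^ 2 * g u + q ^ 2 * g v :=
                le_add_of_nonneg_right (by have := hg0 v; positivity)
        · have hmv : m v < R := lt_of_lt_of_le hlt (min_le_right _ _)
          have hdv : torusDist v y < R := by
            by_contra hc
            have : m v = R := by simp only [hm]; exact min_eq_right (not_lt.mp hc)
            omega
          have hmv' : m v = torusDist v y := by simp only [hm]; exact min_eq_left hdv.le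
          have hgv : g v = 1 / ((torusDist v y : ℝ) + 1) ^ 2 := by simp only [hg, if_pos hdv]
          rw [min_eq_right hlt.le, hmv']
          calc (q / ((torusDist v y : ℕ) + 1 : ℝ)) ^ 2 = q ^ 2 * g v := by
                rw [hgv, div_pow, one_div, div_eq_mul_inv]
            _ ≤ q ^ 2 * g u + q ^ 2 * g v :=
                le_add_of_nonneg_left (by have := hg0 u; positivity)
    -- symmetrise
    have hsym := sum_adj_le_of_le_add (d := 2)
      (fun u v => Real.cosh (q * Real.log (m u + 1) - q * Real.log (m v + 1)) - 1)
      (fun u => q ^ 2 * g u) (fun u => by have := hg0 u; positivity) hkey card_filter_adj_le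
    -- radial summation
    set F : ℕ → ℝ := fun r => if r < R then 1 / ((r : ℝ) + 1) ^ 2 else 0 with hF
    have hF0 : ∀ r, 0 ≤ F r := fun r => by simp only [hF]; split_ifs <;> positivity
    have hgF : ∀ u, g u = F (torusDist u y) := fun u => rfl
    have hrad := sum_radial_le (d := 2) F hF0 y (card_filter_torusDist_eq_le two_pos y)
      (fun u => torusDist_lt u y)
    have hRL : R < L := torusDist_lt x y
    have hterm : ∀ r, ((2 * (2 * (2 * r + 1) ^ (2 - 1)) : ℕ) : ℝ) * F r ≤
        8 * (if r < R then 1 / ((r : ℝ) + 1) else 0) := by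
      intro r
      simp only [hF]
      split_ifs with hr
      · have hr1 : (0 : ℝ) < r + 1 := by positivity
        rw [show ((2 * (2 * (2 * r + 1) ^ (2 - 1)) : ℕ) : ℝ) = 4 * (2 * r + 1) by push_cast; ring]
        rw [mul_one_div, mul_one_div, div_le_div_iff₀ (by positivity) hr1]
        nlinarith
      · simp
    have hharm : ∑ r ∈ range L, (if r < R then 1 / ((r : ℝ) + 1) else 0) ≤
        Real.log (R + 1) + 1 := by
      rw [← sum_filter, show (range L).filter (fun r => r < R) = range R by
        ext r; simp only [mem_filter, mem_range]; omega]
      have h1 : (∑ r ∈ range R, 1 / ((r : ℝ) + 1)) = (harmonic R : ℝ) := by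
        simp only [harmonic, Rat.cast_sum, Rat.cast_inv, Nat.cast_add,
          Nat.cast_one, one_div]
        push_cast; rfl
      have h2 : (harmonic R : ℝ) ≤ harmonic (R + 1) := by
        rw [harmonic_succ]; push_cast
        have : (0 : ℝ) ≤ ((R : ℝ) + 1)⁻¹ := by positivity
        linarith
      have h3 := harmonic_le_one_add_log (R + 1)
      push_cast at h3
      linarith
    calc _ ≤ 2 * (2 * (2 : ℕ)) * ∑ u, q ^ 2 * g u := hsym
      _ = 8 * q ^ 2 * ∑ u, F (torusDist u y) := by
          rw [← mul_sum]; simp only [hgF]; push_cast; ring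
      _ ≤ 8 * q ^ 2 * ∑ r ∈ range L, ((2 * (2 * (2 * r + 1) ^ (2 - 1)) : ℕ) : ℝ) * F r := by
          gcongr
      _ ≤ 8 * q ^ 2 * ∑ r ∈ range L, 8 * (if r < R then 1 / ((r : ℝ) + 1) else 0) :=
          mul_le_mul_of_nonneg_left (sum_le_sum fun r _ => hterm r) (by positivity)
      _ = 64 * q ^ 2 * ∑ r ∈ range L, (if r < R then 1 / ((r : ℝ) + 1) else 0) := by
          rw [← mul_sum]; ring
      _ ≤ 64 * q ^ 2 * (Real.log (R + 1) + 1) := by gcongr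

/-- **Test function on the ring** `ℤ/Lℤ` (uniform in `L`). For `x, y` at torus distance `R` and
`0 ≤ q ≤ 1`, the profile `ψ (u) = q min (dist (u, y), R)` satisfies `ψ x - ψ y = q R` and
`Σ_u Σ_v [u ∼ v] (cosh (ψ u - ψ v) - 1) ≤ 8 q² R` (gradient `≤ q ≤ 1` on the `≤ 2R` sites of the
ball, zero outside; degree `≤ 2`, `#sphere(r) ≤ 2`). Koma–Tasaki's P2 in one dimension reads
`φ_x ≥ q γ |x - y|` (here `γ = 1`). Koma–Tasaki, PRL 68 (1992) 3248, P1, P2 after eq. (11).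
[cite: KomaTasakiPRL1992, properties P1 and P2 after eq. (11)] -/
theorem exists_testFunction_one (x y : TorusSite 1 L) {q : ℝ} (hq0 : 0 ≤ q) (hq1 : q ≤ 1) :
    ∃ ψ : TorusSite 1 L → ℝ,
      ψ x - ψ y = q * torusDist x y ∧
      ∑ u, ∑ v, (if (torusGraph 1 L).Adj u v then Real.cosh (ψ u - ψ v) - 1 else 0) ≤
        8 * q ^ 2 * torusDist x y := by
  set R : ℕ := torusDist x y with hR
  set m : TorusSite 1 L → ℕ := fun u => min (torusDist u y) R with hm
  refine ⟨fun u => q * m u, ?_, ?_⟩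
  · have hx : m x = R := by simp [hm, hR]
    have hy : m y = 0 := by simp [hm]
    show q * (m x : ℝ) - q * (m y : ℝ) = _
    rw [hx, hy]
    simp
  · set g : TorusSite 1 L → ℝ := fun u => if torusDist u y < R then 1 else 0 with hg
    have hg0 : ∀ u, 0 ≤ g u := fun u => by simp only [hg]; split_ifs <;> norm_num
    have hkey : ∀ u v, (torusGraph 1 L).Adj u v →
        Real.cosh (q * m u - q * m v) - 1 ≤ q ^ 2 * g u + q ^ 2 * g v := by
      intro u v huv
      obtain ⟨h1, h2⟩ := min_torusDist_lipschitz y R huv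
      rcases eq_or_ne (m u) (m v) with heq | hne
      · rw [heq, sub_self, Real.cosh_zero, sub_self]
        have := hg0 u; have := hg0 v; positivity
      · have habs : |(m u : ℝ) - m v| ≤ 1 := by
          rw [abs_le]; constructor
          · have : (m v : ℝ) ≤ m u + 1 := by exact_mod_cast h2
            linarith
          · have : (m u : ℝ) ≤ m v + 1 := by exact_mod_cast h1
            linarith
        have hle1 : |q * m u - q * m v| ≤ 1 := by
          rw [← mul_sub, abs_mul, abs_of_nonneg hq0]
          calc q * |(m u : ℝ) - m v| ≤ 1 * 1 := mul_le_mul hq1 habs (abs_nonneg _) zero_le_one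
            _ = 1 := one_mul 1
        have hsq : (q * m u - q * m v) ^ 2 ≤ q ^ 2 := by
          rw [← mul_sub, mul_pow]
          have : ((m u : ℝ) - m v) ^ 2 ≤ 1 := by
            have := (sq_le_sq' (abs_le.mp habs).1 (abs_le.mp habs).2); simpa using this
          nlinarith [sq_nonneg q]
        refine (cosh_sub_one_le_sq hle1).trans (hsq.trans ?_)
        rcases Nat.lt_or_gt_of_ne hne with hlt | hlt
        · have hmu : m u < R := lt_of_lt_of_le hlt (min_le_right _ _)
          have hdu : torusDist u y < R := by
            by_contra hc
            have : m u = R := by simp only [hm]; exact min_eq_right (not_lt.mp hc)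
            omega
          have : g u = 1 := by simp only [hg, if_pos hdu]
          rw [this]; have := hg0 v; nlinarith [sq_nonneg q]
        · have hmv : m v < R := lt_of_lt_of_le hlt (min_le_right _ _)
          have hdv : torusDist v y < R := by
            by_contra hc
            have : m v = R := by simp only [hm]; exact min_eq_right (not_lt.mp hc)
            omega
          have : g v = 1 := by simp only [hg, if_pos hdv]
          rw [this]; have := hg0 u; nlinarith [sq_nonneg q]
    have hsym := sum_adj_le_of_le_add (d := 1)
      (fun u v => Real.cosh (q * m u - q * m v) - 1)
      (fun u => q ^ 2 * g u) (fun u => by have := hg0 u; positivity) hkey card_filter_adj_le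
    set F : ℕ → ℝ := fun r => if r < R then 1 else 0 with hF
    have hF0 : ∀ r, 0 ≤ F r := fun r => by simp only [hF]; split_ifs <;> norm_num
    have hgF : ∀ u, g u = F (torusDist u y) := fun u => rfl
    have hrad := sum_radial_le (d := 1) F hF0 y (card_filter_torusDist_eq_le one_pos y)
      (fun u => torusDist_lt u y)
    have hRL : R < L := torusDist_lt x y
    have hcount : (∑ r ∈ range L, ((1 * (2 * (2 * r + 1) ^ (1 - 1)) : ℕ) : ℝ) * F r) = 2 * R := by
      simp only [hF, mul_ite, mul_one, mul_zero]
      rw [← sum_filter, show (range L).filter (fun r => r < R) = range R by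
        ext r; simp only [mem_filter, mem_range]; omega]
      simp
      ring
    calc _ ≤ 2 * (2 * (1 : ℕ)) * ∑ u, q ^ 2 * g u := hsym
      _ = 4 * q ^ 2 * ∑ u, F (torusDist u y) := by
          rw [← mul_sum]; simp only [hgF]; push_cast; ring
      _ ≤ 4 * q ^ 2 * ∑ r ∈ range L, ((1 * (2 * (2 * r + 1) ^ (1 - 1)) : ℕ) : ℝ) * F r := by
          gcongr
      _ = 8 * q ^ 2 * R := by rw [hcount]; ring

end TestFunctions

end Literature.MathematicalPhysics.QuantumLattice
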